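import Summits.RiemannHypothesis.RiemannHypothesis.Theorems.WeilFormatCWindowMargin
import Summits.RiemannHypothesis.RiemannHypothesis.Theorems.WeilFormatCSectorKernels
import Literature.NumberTheory.LFunctions.WeilGroundEnergyParitySplit
import HarnessLib

/-!
# Format C: the SECTOR MARGIN dictionary — an ODD (resp. EVEN) trigonometric-window certificate with margin `μ`
  gives `μ ≤ ε_od(a) = weilOddGroundEnergy a` (resp. `μ ≤ ε_ev(a)`)

Helper file (`--supports stmt-RiemannHypothesis-18085`, the parity ladder / NoParityCrossing), RH-free.  Prover A
(g21 of unit `sr-gb-rung-a`, route GroundBarta), on the lead's ruling R17-4⁗ (2) (format-C odd-sector λ-door for the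
parity cells beyond `83/100`).  Sequel of weil-3's `WeilFormatCWindowMargin.lean` (margin dictionary for the FULL bottom
`ε(a)`) using weil-2's orthonormality `integral_norm_sq_sum_smul_chi`, weil-2's sector split
`sum_modes_mul_mul_eq_sectors` and the tree's `le_weilOddGroundEnergy_of_forall` / `le_weilEvenGroundEnergy_of_forall`.

The parity ladder's L-sides are ODD-sector lower bounds `λ ≤ ε_od(c)` (a cell `[b, c]` of `NoParityCrossing` closes by
`ε(b) ≤ U < λ ≤ ε_od(c)`, `ε` antitone, `ε_od` antitone).  A format-C kernel certificate proves `M − λ'·1 ⪰ 0` for a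
sector kernel `M`; this file turns such a certificate into the sector margin statement:

* `fourierCoeff_neg_index_of_odd/_of_even`: the window Fourier coefficients of an odd (even) `φ` form an odd (even) vector;
* `le_weilOddGroundEnergy_of_odd_trig_margin`: if `μ‖u‖₂² ≤ weilWindowForm a u` on every ODD trigonometric window
  `u = Σ_{|n|≤N} c_n χ_n`, `c_{−n} = −c_n`, then `μ ≤ weilOddGroundEnergy a` (pass to the limit along the truncated Fourier
  series of an odd test function, which are odd trigonometric windows); `…Even…` likewise;
* `le_weilOddGroundEnergy_of_odd_gram_margin` / `…_of_odd_real_gram_margin`: Gram forms (complex odd / real odd vectors);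
* `le_weilOddGroundEnergy_of_odd_kernel_margin` — **the door the kernel certificate targets**: for an abstract real Gram
  kernel `G` (`weilWindowSesq a χ_m χ_n = ↑(G m n)`, `G(−n,−m) = G(n,m)`) and the ODD sector kernel
  `M⁻_G(k,l) = (G(k+1,l+1) − G(k+1,−(l+1)))/2` of `WeilFormatCSectorKernels.lean`:
  `(∀ K z, (μ/2)·Σ_{k<K} z_k² ≤ Σ_{k,l<K} z_k z_l M⁻_G(k,l)) → μ ≤ weilOddGroundEnergy a`
  (the orthonormal odd basis is `(χ_{k+1} − χ_{−(k+1)})/√2`, whose kernel is `2M⁻_G` — hence the `μ/2`).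

Standard axioms; nothing is defined; no RH claim.
-/

set_option autoImplicit false
-- `Summit.RiemannHypothesis.RiemannHypothesis.…` is the layout-mandated namespace (summit = problem name).
set_option linter.dupNamespace false

noncomputable section

open Complex Filter Set MeasureTheory Finset
open scoped Real Topology ComplexConjugate BigOperators

namespace Summit.RiemannHypothesis.RiemannHypothesis.Theorems.WeilFormatC

open Literature.NumberTheory.LFunctions
open Literature.NumberTheory.LFunctions.Yoshida1992 (modes chi proj C_le_K mem_modes)

variable {a : ℝ}

/-! ## §1 Parity of the window Fourier coefficients -/

/-- The window Fourier coefficients of an ODD function form an odd vector: `c_{−n}(φ) = −c_n(φ)`. [folklore] -/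
theorem fourierCoeff_neg_index_of_odd {φ : ℝ → ℂ} (hodd : ∀ x, φ (-x) = -φ x) (n : ℤ) :
    Yoshida1992.fourierCoeff a (-n) φ = -Yoshida1992.fourierCoeff a n φ := by
  unfold Yoshida1992.fourierCoeff
  rw [← intervalIntegral.integral_neg]
  have hsub := intervalIntegral.integral_comp_neg (a := -a) (b := a)
    (f := fun x : ℝ ↦ φ x * cexp (-(π * I * ((-n : ℤ) : ℂ) * x / a)))
  rw [neg_neg] at hsub
  rw [← hsub]
  refine intervalIntegral.integral_congr fun x _ ↦ ?_
  simp only [hodd, Int.cast_neg, Complex.ofReal_neg]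
  ring_nf

/-- The window Fourier coefficients of an EVEN function form an even vector: `c_{−n}(φ) = c_n(φ)`. [folklore] -/
theorem fourierCoeff_neg_index_of_even {φ : ℝ → ℂ} (heven : ∀ x, φ (-x) = φ x) (n : ℤ) :
    Yoshida1992.fourierCoeff a (-n) φ = Yoshida1992.fourierCoeff a n φ := by
  unfold Yoshida1992.fourierCoeff
  have hsub := intervalIntegral.integral_comp_neg (a := -a) (b := a)
    (f := fun x : ℝ ↦ φ x * cexp (-(π * I * ((-n : ℤ) : ℂ) * x / a)))
  rw [neg_neg] at hsub
  rw [← hsub]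
  refine intervalIntegral.integral_congr fun x _ ↦ ?_
  simp only [heven, Int.cast_neg, Complex.ofReal_neg]
  ring_nf

/-! ## §2 The sector margin dictionary (window form) -/

/-- **Odd margin dictionary (window form).** Let `a > 0`. If `μ ∫‖u‖² ≤ weilWindowForm a u` for every ODD
trigonometric window `u = Σ_{|n| ≤ N} c_n χ_n` (`c_{−n} = −c_n`), then `μ ∫‖g‖² ≤ Re Q(g)` for every ODD test function
`g` supported in `[-a, a]`. [folklore] -/
theorem odd_window_margin_of_odd_trig_margin (ha : 0 < a) {μ : ℝ}
    (h : ∀ (N : ℕ) (c : ℤ → ℂ), (∀ n, c (-n) = -c n) →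
      μ * ∫ x : ℝ, ‖(∑ n ∈ modes N, c n • chi a n) x‖ ^ 2 ≤ weilWindowForm a (∑ n ∈ modes N, c n • chi a n))
    {g : ℝ → ℂ} (hg : IsWeilTest g) (hsupp : tsupport g ⊆ Icc (-a) a) (hodd : ∀ t, g (-t) = -g t) :
    μ * ∫ x : ℝ, ‖g x‖ ^ 2 ≤ (weilQuadratic g).re := by
  have hK : g ∈ Yoshida1992.K a := C_le_K ha ⟨hg, hsupp⟩
  rw [← weilWindowForm_eq_re_weilQuadratic hg hsupp]
  refine le_of_tendsto_of_tendsto' ((tendsto_integral_norm_sq_proj ha hK).const_mul μ)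
    (tendsto_weilWindowForm_proj ha hK) fun N ↦ ?_
  refine h N (fun n ↦ (((1 / Real.sqrt (2 * a) : ℝ) : ℂ) * Yoshida1992.fourierCoeff a n g)) fun n ↦ ?_
  rw [fourierCoeff_neg_index_of_odd hodd, mul_neg]

/-- **Even margin dictionary (window form).** As `odd_window_margin_of_odd_trig_margin`, for EVEN windows / tests. [folklore] -/
theorem even_window_margin_of_even_trig_margin (ha : 0 < a) {μ : ℝ}
    (h : ∀ (N : ℕ) (c : ℤ → ℂ), (∀ n, c (-n) = c n) →
      μ * ∫ x : ℝ, ‖(∑ n ∈ modes N, c n • chi a n) x‖ ^ 2 ≤ weilWindowForm a (∑ n ∈ modes N, c n • chi a n))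
    {g : ℝ → ℂ} (hg : IsWeilTest g) (hsupp : tsupport g ⊆ Icc (-a) a) (heven : ∀ t, g (-t) = g t) :
    μ * ∫ x : ℝ, ‖g x‖ ^ 2 ≤ (weilQuadratic g).re := by
  have hK : g ∈ Yoshida1992.K a := C_le_K ha ⟨hg, hsupp⟩
  rw [← weilWindowForm_eq_re_weilQuadratic hg hsupp]
  refine le_of_tendsto_of_tendsto' ((tendsto_integral_norm_sq_proj ha hK).const_mul μ)
    (tendsto_weilWindowForm_proj ha hK) fun N ↦ ?_
  refine h N (fun n ↦ (((1 / Real.sqrt (2 * a) : ℝ) : ℂ) * Yoshida1992.fourierCoeff a n g)) fun n ↦ ?_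
  rw [fourierCoeff_neg_index_of_even heven]

/-- **Odd margin dictionary (sector bottom).** Under the hypothesis of `odd_window_margin_of_odd_trig_margin`,
`μ ≤ weilOddGroundEnergy a`. [folklore] -/
theorem le_weilOddGroundEnergy_of_odd_trig_margin (ha : 0 < a) {μ : ℝ}
    (h : ∀ (N : ℕ) (c : ℤ → ℂ), (∀ n, c (-n) = -c n) →
      μ * ∫ x : ℝ, ‖(∑ n ∈ modes N, c n • chi a n) x‖ ^ 2 ≤ weilWindowForm a (∑ n ∈ modes N, c n • chi a n)) :
    μ ≤ weilOddGroundEnergy a := by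
  refine le_weilOddGroundEnergy_of_forall ha fun g hg hsupp hodd hnorm ↦ ?_
  have := odd_window_margin_of_odd_trig_margin ha h hg hsupp hodd
  rwa [hnorm, mul_one] at this

/-- **Even margin dictionary (sector bottom).** Under the hypothesis of `even_window_margin_of_even_trig_margin`,
`μ ≤ weilEvenGroundEnergy a`. [folklore] -/
theorem le_weilEvenGroundEnergy_of_even_trig_margin (ha : 0 < a) {μ : ℝ}
    (h : ∀ (N : ℕ) (c : ℤ → ℂ), (∀ n, c (-n) = c n) →
      μ * ∫ x : ℝ, ‖(∑ n ∈ modes N, c n • chi a n) x‖ ^ 2 ≤ weilWindowForm a (∑ n ∈ modes N, c n • chi a n)) :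
    μ ≤ weilEvenGroundEnergy a := by
  refine le_weilEvenGroundEnergy_of_forall ha fun g hg hsupp heven hnorm ↦ ?_
  have := even_window_margin_of_even_trig_margin ha h hg hsupp heven
  rwa [hnorm, mul_one] at this

/-! ## §3 Gram forms -/

/-- **Odd margin dictionary (Gram form).** Let `a > 0`, `G(m,n) = weilWindowSesq a χ_m χ_n`. If
`μ Σ_{|n|≤N} |c_n|² ≤ Re Σ_{m,n} c_m conj(c_n) G(m,n)` for all `N` and all ODD `c`, then `μ ≤ weilOddGroundEnergy a`. [folklore] -/
theorem le_weilOddGroundEnergy_of_odd_gram_margin (ha : 0 < a) {μ : ℝ}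
    (h : ∀ (N : ℕ) (c : ℤ → ℂ), (∀ n, c (-n) = -c n) → μ * ∑ n ∈ modes N, ‖c n‖ ^ 2 ≤
      (∑ m ∈ modes N, ∑ n ∈ modes N, c m * conj (c n) * weilWindowSesq a (chi a m) (chi a n)).re) :
    μ ≤ weilOddGroundEnergy a := by
  refine le_weilOddGroundEnergy_of_odd_trig_margin ha fun N c hc ↦ ?_
  rw [integral_norm_sq_sum_smul_chi ha (modes N) c,
    weilWindowForm_sum_smul_eq_re ha.le (modes N) (fun n _ ↦ isWindowFunction_chi ha n) c a]
  exact h N c hc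

/-- **Odd margin dictionary (REAL Gram form).** If the Gram entries are real and `μ Σ x_n² ≤ Σ x_m x_n Re G(m,n)` for every
`N` and every ODD real vector `x` (`x_{−n} = −x_n`), then `μ ≤ weilOddGroundEnergy a`. [folklore] -/
theorem le_weilOddGroundEnergy_of_odd_real_gram_margin (ha : 0 < a) {μ : ℝ}
    (hreal : ∀ m n : ℤ, (weilWindowSesq a (chi a m) (chi a n)).im = 0)
    (h : ∀ (N : ℕ) (x : ℤ → ℝ), (∀ n, x (-n) = -x n) → μ * ∑ n ∈ modes N, x n ^ 2 ≤
      ∑ m ∈ modes N, ∑ n ∈ modes N, x m * x n * (weilWindowSesq a (chi a m) (chi a n)).re) :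
    μ ≤ weilOddGroundEnergy a := by
  refine le_weilOddGroundEnergy_of_odd_gram_margin ha fun N c hc ↦ ?_
  rw [re_sum_sum_mul_conj_mul_eq (modes N) (fun m _ n _ ↦ hreal m n) c]
  have hsplit : ∑ n ∈ modes N, ‖c n‖ ^ 2 =
      (∑ n ∈ modes N, (c n).re ^ 2) + ∑ n ∈ modes N, (c n).im ^ 2 := by
    rw [← Finset.sum_add_distrib]
    exact Finset.sum_congr rfl fun n _ ↦ by rw [Complex.sq_norm, Complex.normSq_apply]; ring
  rw [hsplit, mul_add]
  have hre : ∀ n, (c (-n)).re = -(c n).re := fun n ↦ by rw [hc n, Complex.neg_re]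
  have him : ∀ n, (c (-n)).im = -(c n).im := fun n ↦ by rw [hc n, Complex.neg_im]
  exact add_le_add (h N (fun n ↦ (c n).re) hre) (h N (fun n ↦ (c n).im) him)

/-! ## §4 The odd SECTOR KERNEL with margin -/

/-- For an ODD real vector `x` on `modes N` the full quadratic form of a reflection-symmetric kernel `G` is the odd sector
form on `z_k = 2·x_{k+1}`: `Σ_{n,m ∈ modes N} x_n x_m G(n,m) = Σ_{k,l<N} (2x_{k+1})(2x_{l+1}) M⁻_G(k,l)`. [folklore] -/
theorem sum_modes_mul_mul_eq_odd_sector_of_odd (G : ℤ → ℤ → ℝ) (hrefl : ∀ n m, G (-n) (-m) = G n m)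
    (N : ℕ) {x : ℤ → ℝ} (hx : ∀ n, x (-n) = -x n) :
    ∑ n ∈ modes N, ∑ m ∈ modes N, x n * x m * G n m =
      ∑ k ∈ Finset.range N, ∑ l ∈ Finset.range N,
        (2 * x ((k : ℤ) + 1)) * (2 * x ((l : ℤ) + 1)) *
          ((G ((k : ℤ) + 1) ((l : ℤ) + 1) - G ((k : ℤ) + 1) (-((l : ℤ) + 1))) / 2) := by
  have hx0 : x 0 = 0 := by
    have h := hx 0
    rw [neg_zero] at h
    linarith
  rw [sum_modes_mul_mul_eq_sectors G hrefl N x]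
  have hev : ∑ n ∈ Finset.range (N + 1), ∑ m ∈ Finset.range (N + 1),
      (if n = 0 then x 0 else x n + x (-(n : ℤ))) * (if m = 0 then x 0 else x m + x (-(m : ℤ))) *
        (if n = 0 then G 0 m else if m = 0 then G n 0 else (G n m + G n (-(m : ℤ))) / 2) = 0 := by
    refine Finset.sum_eq_zero fun n _ ↦ Finset.sum_eq_zero fun m _ ↦ ?_
    have hn : (if n = 0 then x 0 else x n + x (-(n : ℤ))) = 0 := by
      split_ifs
      · exact hx0
      · rw [hx]; ring
    rw [hn]; ring
  rw [hev, zero_add]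
  refine Finset.sum_congr rfl fun k _ ↦ Finset.sum_congr rfl fun l _ ↦ ?_
  rw [hx ((k : ℤ) + 1), hx ((l : ℤ) + 1)]
  ring

/-- For an ODD real vector `x` on `modes N`: `Σ_{n ∈ modes N} x_n² = 2 Σ_{k<N} x_{k+1}²`. [folklore] -/
theorem sum_modes_sq_eq_of_odd (N : ℕ) {x : ℤ → ℝ} (hx : ∀ n, x (-n) = -x n) :
    ∑ n ∈ modes N, x n ^ 2 = 2 * ∑ k ∈ Finset.range N, x ((k : ℤ) + 1) ^ 2 := by
  -- the identity kernel is reflection symmetric; its odd sector kernel is `δ/2`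
  have h := sum_modes_mul_mul_eq_odd_sector_of_odd (fun n m : ℤ ↦ if n = m then (1 : ℝ) else 0)
    (fun n m ↦ by simp only [neg_inj]) N hx
  have lhs : ∑ n ∈ modes N, ∑ m ∈ modes N, x n * x m * (if n = m then (1 : ℝ) else 0) =
      ∑ n ∈ modes N, x n ^ 2 := by
    refine Finset.sum_congr rfl fun n hn ↦ ?_
    simp only [mul_ite, mul_one, mul_zero, Finset.sum_ite_eq, if_pos hn]
    ring
  have rhs : ∑ k ∈ Finset.range N, ∑ l ∈ Finset.range N,
      (2 * x ((k : ℤ) + 1)) * (2 * x ((l : ℤ) + 1)) *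
        (((if (k : ℤ) + 1 = (l : ℤ) + 1 then (1 : ℝ) else 0) - (if (k : ℤ) + 1 = -((l : ℤ) + 1) then (1 : ℝ) else 0)) / 2) =
      2 * ∑ k ∈ Finset.range N, x ((k : ℤ) + 1) ^ 2 := by
    rw [Finset.mul_sum]
    refine Finset.sum_congr rfl fun k hk ↦ ?_
    have hne : ∀ l : ℕ, ((k : ℤ) + 1 = -((l : ℤ) + 1)) ↔ False := fun l ↦ by
      constructor
      · intro h; omega
      · intro h; exact h.elim
    simp only [hne, if_false, sub_zero]
    rw [Finset.sum_eq_single_of_mem k hk]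
    · simp only [if_true]; ring
    · intro l _ hlk
      have : ¬ ((k : ℤ) + 1 = (l : ℤ) + 1) := by
        intro h; apply hlk; exact_mod_cast (by omega : (l : ℤ) = k)
      simp only [this, if_false]; ring
  rw [lhs, rhs] at h
  exact h

/-- **The odd-sector margin door (kernel form).** Let `a > 0` and let `G : ℤ → ℤ → ℝ` be the real Gram kernel of the window
form on Yoshida's basis, `weilWindowSesq a χ_m χ_n = ↑(G m n)`, with `G(−n,−m) = G(n,m)`.  If the ODD sector kernel
`M⁻_G(k,l) = (G(k+1,l+1) − G(k+1,−(l+1)))/2` dominates `(μ/2)·1` on every `range K`, then `μ ≤ weilOddGroundEnergy a`. [folklore] -/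
theorem le_weilOddGroundEnergy_of_odd_kernel_margin (ha : 0 < a) (G : ℤ → ℤ → ℝ)
    (hG : ∀ m n : ℤ, weilWindowSesq a (chi a m) (chi a n) = ((G m n : ℝ) : ℂ))
    (hrefl : ∀ n m, G (-n) (-m) = G n m) {μ : ℝ}
    (hod : ∀ (K : ℕ) (z : ℕ → ℝ), μ / 2 * ∑ k ∈ Finset.range K, z k ^ 2 ≤
      ∑ k ∈ Finset.range K, ∑ l ∈ Finset.range K,
        z k * z l * ((G ((k : ℤ) + 1) ((l : ℤ) + 1) - G ((k : ℤ) + 1) (-((l : ℤ) + 1))) / 2)) :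
    μ ≤ weilOddGroundEnergy a := by
  refine le_weilOddGroundEnergy_of_odd_real_gram_margin ha (im_weilWindowSesq_chi_eq_zero_of_eq G hG) fun N x hx ↦ ?_
  have e : ∑ m ∈ modes N, ∑ n ∈ modes N, x m * x n * (weilWindowSesq a (chi a m) (chi a n)).re
      = ∑ n ∈ modes N, ∑ m ∈ modes N, x n * x m * G n m := by
    refine Finset.sum_congr rfl fun m _ ↦ Finset.sum_congr rfl fun n _ ↦ ?_
    rw [hG m n, Complex.ofReal_re]
  rw [e, sum_modes_mul_mul_eq_odd_sector_of_odd G hrefl N hx, sum_modes_sq_eq_of_odd N hx]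
  have h := hod N fun k ↦ 2 * x ((k : ℤ) + 1)
  have e2 : ∑ k ∈ Finset.range N, (2 * x ((k : ℤ) + 1)) ^ 2 = 4 * ∑ k ∈ Finset.range N, x ((k : ℤ) + 1) ^ 2 := by
    rw [Finset.mul_sum]
    exact Finset.sum_congr rfl fun k _ ↦ by ring
  rw [e2] at h
  linarith

/-- **The odd-sector margin door (shifted-kernel form)** — the shape a format-C certificate of `M⁻_G − λ'·1 ⪰ 0` delivers:
nonnegativity of the SHIFTED odd kernel on every `range K` gives `2λ' ≤ weilOddGroundEnergy a`. [folklore] -/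
theorem le_weilOddGroundEnergy_of_shifted_odd_kernel_nonneg (ha : 0 < a) (G : ℤ → ℤ → ℝ)
    (hG : ∀ m n : ℤ, weilWindowSesq a (chi a m) (chi a n) = ((G m n : ℝ) : ℂ))
    (hrefl : ∀ n m, G (-n) (-m) = G n m) {lam : ℝ}
    (hod : ∀ (K : ℕ) (z : ℕ → ℝ), 0 ≤ ∑ k ∈ Finset.range K, ∑ l ∈ Finset.range K,
      z k * z l * (((G ((k : ℤ) + 1) ((l : ℤ) + 1) - G ((k : ℤ) + 1) (-((l : ℤ) + 1))) / 2)
        - if k = l then lam else 0)) :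
    2 * lam ≤ weilOddGroundEnergy a := by
  refine le_weilOddGroundEnergy_of_odd_kernel_margin ha G hG hrefl fun K z ↦ ?_
  have h := hod K z
  have e : ∑ k ∈ Finset.range K, ∑ l ∈ Finset.range K,
      z k * z l * (((G ((k : ℤ) + 1) ((l : ℤ) + 1) - G ((k : ℤ) + 1) (-((l : ℤ) + 1))) / 2) - if k = l then lam else 0) =
      (∑ k ∈ Finset.range K, ∑ l ∈ Finset.range K,
        z k * z l * ((G ((k : ℤ) + 1) ((l : ℤ) + 1) - G ((k : ℤ) + 1) (-((l : ℤ) + 1))) / 2)) -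
        lam * ∑ k ∈ Finset.range K, z k ^ 2 := by
    simp only [mul_sub, Finset.sum_sub_distrib, mul_ite, mul_zero]
    congr 1
    rw [Finset.mul_sum]
    refine Finset.sum_congr rfl fun k hk ↦ ?_
    rw [Finset.sum_ite_eq (Finset.range K) k, if_pos hk]
    ring
  rw [e] at h
  have : 2 * lam / 2 = lam := by ring
  rw [this]
  linarith

/-! ## §5 Bookkeeping for the diagonal shift (used by the λ-door files)

The λ-doors (`WeilFormatCOddMarginDoorA.lean`, prover A g22: `le_weilOddGroundEnergy_of_formatC_oddPiecesA`, the kit twin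
`le_weilOddGroundEnergy_of_kitCBM_odd`) move the shift `[k = l]·λ` between a kernel and the quadratic form; these are the two
identities they use, once over a `Finset ℕ` and once over `Fin B` (the `PsdDyadic` certificate's indexing). -/

/-- `Σ_{k,l∈s} z_k (M(k,l) − [k=l]·λ) z_l = Σ_{k,l∈s} z_k M(k,l) z_l − λ Σ_{k∈s} z_k²`. [folklore] -/
theorem sum_sum_mul_shift_mul (s : Finset ℕ) (M : ℕ → ℕ → ℝ) (lam : ℝ) (z : ℕ → ℝ) :
    ∑ k ∈ s, ∑ l ∈ s, z k * (M k l - if k = l then lam else 0) * z l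
      = (∑ k ∈ s, ∑ l ∈ s, z k * M k l * z l) - lam * ∑ k ∈ s, z k ^ 2 := by
  simp only [mul_sub, sub_mul, Finset.sum_sub_distrib, mul_ite, ite_mul, mul_zero, zero_mul]
  congr 1
  rw [Finset.mul_sum]
  refine Finset.sum_congr rfl fun k hk ↦ ?_
  rw [Finset.sum_ite_eq s k, if_pos hk]
  ring

/-- `Σ_{i,j} x_i x_j (M(i,j) − [i=j]·λ) = Σ_{i,j} x_i x_j M(i,j) − λ Σ_i x_i²` on `Fin B`. [folklore] -/
theorem sum_sum_mul_mul_shift {B : ℕ} (M : ℕ → ℕ → ℝ) (lam : ℝ) (x : Fin B → ℝ) :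
    ∑ i : Fin B, ∑ j : Fin B, x i * x j * (M i j - if (i : ℕ) = j then lam else 0)
      = (∑ i : Fin B, ∑ j : Fin B, x i * x j * M i j) - lam * ∑ i : Fin B, x i ^ 2 := by
  simp only [mul_sub, Finset.sum_sub_distrib, mul_ite, mul_zero]
  congr 1
  rw [Finset.mul_sum]
  refine Finset.sum_congr rfl fun i _ ↦ ?_
  simp only [Fin.val_inj, Finset.sum_ite_eq, Finset.mem_univ, if_true]
  ring

end Summit.RiemannHypothesis.RiemannHypothesis.Theorems.WeilFormatC

end
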